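import Summits.AtomisticToContinuum.Crystallization.Theses.PricedLinkCensus

/-!
# Disproof of `LocalToGlobal` — findings (cdisprove seat, crux `stmt-AtomisticToContinuum-14232`, gen 2)

The crux (route `PricedLinkCensus`, rank 4) is the material implication

  `LocalToGlobal : TruncatedCensusGap → ChargedEnergyGap`

between two open sibling cruxes (items 14230, 14231): the range-2 census gap for
`V_χ = min 1 (max 0 (4 − 2r)) · V_LJ` should imply the full Lennard-Jones priced gap
`E_LJ(y) ≥ N e* + κ·#charged(y) − C N^{2/3}` (`e* = ⨅_Q e_LJ(Q)`, charge = `¬ IsChargeFree (1/100)`).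

VERDICT (standing): **resists a Lean kill by construction** — `¬ LocalToGlobal ↔ TruncatedCensusGap ∧
¬ ChargedEnergyGap` (`not_localToGlobal_iff`), and BOTH conjuncts need a LOWER bound on a periodic
infimum (`e_χ*` resp. `e*`) sharp at the 1e−6 level, i.e. energetic crystallization in `d = 3`.
Everything conclusive below is therefore NEGATIVE KNOWLEDGE FOR THE PROVERS: which hypotheses are
load-bearing, which natural transfer lemmas are false, and why.  Sorry-free unless marked `near-miss`.

## Index of findings

* §0 read-back (`truncatedCensusGap_iff`, `chargedEnergyGap_iff`, `localToGlobal_iff`: `Iff.rfl`).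
* §1 logic: `localToGlobal_of_chargedEnergyGap`, `localToGlobal_of_not_truncatedCensusGap`,
  `not_localToGlobal_iff` — the crux closes trivially from EITHER sibling verdict; a refutation needs a
  PROOF of the XL antecedent.
* §2 junk audit of the potential: `Vchi_zero` (`V_χ 0 = 0`, `0⁻¹ = 0`), `Vchi_one = −1/12`,
  `lennardJones_le_of_mem_Icc` (`V_LJ ≤ −1/768` on `[1, 2]`).
* §3 LOAD-BEARING `Function.Injective` (in the consequent AND the antecedent):
  `chargedEnergyGap_false_without_injective`, `truncatedCensusGap_false_without_injective` — two
  coincident stacks of `m` points have energy `−m²/12` (super-extensive) because `V 0 = 0`; fails for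
  every `κ`, `C` and EVERY value of the periodic infimum.  (The sibling seat certifies the antecedent's
  version independently: `Cruxes/TruncatedCensusGap/Disproof.lean`, `not_gapAtWithoutInjective`.)
* §5 CARD FIRST-LEMMA AUDIT (round-1 ideas; statements copied verbatim, the sketch modules are not
  built on the farm): `not_weakFarField` — the cut-and-adapt card's "free" regional far-field bound is
  FALSE as stated (no hard core: the half-pair site functional is unbounded below under crowding);
  and `not_fragileChargePricing` (§5b) — its "fragile charge is elastic" regional statement is FALSE as
  stated too (crowding around the certified charge-free centre of the exact fcc 13-cluster); REPAIR for
  both: a minimal-distance hypothesis, which regional statements cannot inherit from global energy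
  minimality.  POSITIVE BY-PRODUCTS (§5b): `isChargeFree_iff_comp_of_far` (locality of charge) and
  `isChargeFree_fcc13_zero` (first certified charge-free site in the tree).
* §4 GAUGE-COVARIANT TRANSFERS LEAK AT TWIST WALLS (new): every round-1 card consumes the antecedent
  on an image of `y` under a gauge and needs a domination inequality with a uniform constant
  (`CutAndAdaptDomination`, Claim G, `RelativeCoercivity`); hcp bicrystal laminates with low-angle TWIST
  walls defeat all of them (paper argument in the §4 docblock; certified kernel
  `no_rankOne_connection_twist`: the two uniaxially adapted wells have no rank-one connection across a
  wall whose normal is the rotation axis; tilt walls are compatible) and its QUANTITATIVE form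
  `twist_wells_gap` (the wells are uniformly `≥ 4αpq/7` apart on the tangential test vectors).
* §6 NEAR-MISSES (sorry'd, docstrings carry witness + obstruction to certification):
  `not_cutAndAdaptDomination_nearMiss`, `not_relativeCoercivity_nearMiss` and
  `not_robustChargeViaCensusInner_nearMiss` (teleported vacancy filling) — all with `e*`/`e_χ*` on the
  favourable side, uncertifiable without a periodic-infimum lower bound.  The card statements are copied verbatim with VERDICT docstrings
  (`CutAndAdapt.CutAndAdaptDomination`, `ShapeTransfer.RelativeCoercivity`).

## Verdicts on the four round-1 cards' first lemmas (for the triage panel)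

* `cut-and-adapt-envelope`: `CutAndAdaptDomination` (TL) false on paper via twist walls (§4, near-miss
  §6); companions `WeakFarField`, `FragileChargePricing` FALSE AS STATED (certified §5/§5b, misstated:
  no hard core); and even the "bookkeeping" step `RobustChargeViaCensus` is false as stated
  (TELEPORTED VACANCY FILLING, near-miss §6: `interfaceCount` is read in `y` only, so a far class can be
  translated into another class's vacancies at zero interface cost, healing robust charge in the image).
* `criticality-matching-gauge`: Claim G (relative coercivity after a piecewise uniaxial gauge, cuts only
  along CHARGED walls) leaks at charge-free low-angle twist walls exactly like TL (§4); its first lemma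
  `AffineGaugeChargeInvariance` is plausibly TRUE (all bonds/ring numbers entering `IsChargeFree η · i`
  live on `i`'s bonded neighbours, cf. the locality lemma of §5b) — a lemma, not a risk.
* `scale-free-shape-transfer`: `RelativeCoercivity` false by the ideator's own mismatch lemma
  (`m_χ N` vs `O(N^{2/3})`, near-miss §6); `PeriodicPricedGap`/`LinNearMin` are `ChargedEnergyGap` in
  periodic clothes (equivalent, not easier).
* `flux-cell-joint-census`: `LocalPricedGap` implies `ChargedEnergyGap` (proved in the sketch) and is at
  least as hard; NO cheap kill: own-scale windows `ρ₀·nn_i` are invisible to far crowds, but a crowd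
  dense enough to matter pays its hard core inside `E_LJ` (checked: invisibility/recombination
  arguments give back only `ChargedEnergyGap` for sub-configurations).  Its risk is the size of the
  certificate, not falsity.

## Inherited from gen 1 (evidence files `Disproof.lean` 2026-08-15T22:41Z–22:53Z and `NUMERICS.md`
## on the item; NOT readable from this seat's jail, reconstructed from the evidence notes)

* (D1) ADDITIVE SPLIT IS DEAD: `chargedEnergyGap_of_additive_split` would close the crux from a tail
  bound `E_tail(y) ≥ N(e* − e_χ*) − κ'#ch − C N^{2/3}`, but `not_tailDominance` holds for EVERY `κ'`
  (two dense clusters: the far field `V_LJ(1−χ)` alone has no hard core, `≤ −m²/5000`).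
* (D2) POINTWISE OWN-SCALE BARLOW SHELL COUNTING IS FALSE: a 33-point polyicosahedral cluster has 32
  sites within `1.65ρ` of its (charged, ring numbers 0) centre vs the Barlow maximum 20
  (`not_barlowSharpShellCount`, `not_ownScaleBarlowShellCount`; integer distance table, `decide`).
* (§7 of gen 1) CERTIFIED ENERGY FORM of D2: at its own scale the icosahedral centre beats every Barlow
  site inside the window `1.65ν` for BOTH `E_χ` (by ≥ 1/25 resp. 1/20) and the far field (1/50, 1/40).
* hidden obligations: `ChargedEnergyGap ⇒ e* ≤ −κ < 0 ⇒ BddBelow (range e_LJ)`; `TCG ⇒ e_χ* ≤ −κ_T`.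
* numerics (pure-python lattice sums, tree units): `e* = −0.717594` (hcp; hcp−fcc = −7.2e−5),
  `e_χ* = −0.608667`, `t* = e* − e_χ* = −0.108928`, slopes `de_tail/da = +0.286`, `de_χ/da = −0.284`
  (first-order tail/compression coupling, `δ₀ = e_χ(hcp at a*) − e_χ* = 7.76e−4`), hcp `c/a` under
  `V_χ` 1.63142, κ ceiling 6.9e−5 per charged site (one atom displaced 0.5–0.7 %), refined by the
  sibling seat to 2.7e−5 (relaxed compressed pair: 20 charged sites for ΔE = 5.4e−4).

## Numerics (gen 2; kit j007121 = quick protocol, exit 0, `compute/ljsearch.py`; full protocol j007122 pending)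

Pure numpy/scipy, tree conventions (`V_LJ = r⁻¹²/12 − r⁻⁶/6`, `V_χ = χ V_LJ`), lattice sums to `R_c = 12`
plus continuum tail (LJ) / exact (χ); bond graph and ring numbers EXACTLY as in `BondGraph.lean`.
* References (agree with gen 1 / ideators to 1e−6): LJ fcc −0.7175134 (a = 0.97125), hcp −0.7175879
  (a = 0.97129, c/a = 1.632763), dhcp −0.7175513; `V_χ` fcc −0.6084271 (a = 0.97704), hcp −0.6086690
  (a = 0.97707, c/a = 1.631418), dhcp −0.6085470.  Both potentials: hcp < dhcp < fcc.
* Inputs (U2) of §4, reproduced independently: `a_χ/a_V = 1.005948`, `c/a` mismatch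
  `α = (c/a)_χ/(c/a)_V − 1 = −8.24e−4`, `δ₀ = e_χ(hcp_V) − e_χ* = 7.71e−4`, dilation sliver
  `m_χ = 1.84e−6` at `s = 1.005672`, `c/a` stiffness per particle `K'_χ = 5.42`, `K'_V = 6.20`.
* κ CEILINGS (hcp 8×8×5 supercell, N = 640, perfect cell 0 charged; cheapest charged excitation =
  ONE bond held at `(1 − 1.000 %)·a` by a restraint, everything else relaxed): 20 charged sites for
  `ΔE_LJ = 9.34e−4` ⇒ **κ_B ≤ 4.7e−5** (full LJ, `ChargedEnergyGap`); `ΔE_χ = 8.45e−4` ⇒ κ_T ≤ 4.2e−5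
  (sibling seat: 2.7e−5 with its protocol).  Single atom pushed 1 % (unrelaxed): 9.3e−5 / 8.4e−5;
  alternating row pinch: 8.6e−5 / 7.8e−5 (56 charged per 8-row).  Uniform `c`-strain up to ±1.2 %
  charges NOTHING (bond split ≈ ⅔ε < 1 %) while costing up to 1.2e−3 per site: the census is blind to
  sub-threshold strain by design, so any valid κ is an elastic constant ~4e−5, three orders of
  magnitude below the bond energy 1/12.
* Blind variable-cell search (quick: 6 random starts per n ≤ 4, two-stage cutoff): every low minimum
  is fcc (n = 1–3) or hcp (n = 4) for BOTH potentials, all motif sites charge-free (12 bonds, rings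
  4,…,4), nothing below hcp.  The full protocol (120 starts, n ≤ 6, finer δ-scan) is job j007122.

## Why it resists (for every refuting strategy) — and what that tells the prover

`¬ LocalToGlobal` needs `TruncatedCensusGap` PROVED.  More generally every statement in this crux in
which `e*` or `e_χ*` sits on the favourable side is downward closed in that infimum, so a refutation
must certify a LOWER bound on a periodic infimum at the scale of the witness's slack (1e−6…1e−3 per
particle): open.  The loopholes that need no lower bound are unbounded energy DENSITIES — available
exactly where a hard core is missing: non-injective configurations (§3), tail-only functionals (D1),
regional half-pair functionals (§5, §5b).  Conversely, for the PROVER: `E ≥ N e*` and `E_χ ≥ N e_χ*` are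
free by periodisation, the `−C N^{2/3}` is removable, and 100 % of the content is κ-pricing near the
minimum; the antecedent cannot be consumed additively (D1/δ₀), nor pointwise at own scale (D2), nor —
new in gen 2, §4 — through ANY gauge/re-gauging with a configuration-uniform constant (twist walls).
-/

noncomputable section

open scoped BigOperators RealInnerProductSpace
open Literature.MathematicalPhysics.StatisticalMechanics Literature.Geometry.DiscreteGeometry
open Summit.AtomisticToContinuum.Crystallization.Theses.PricedLinkCensus

namespace Summit.AtomisticToContinuum.Crystallization.Cruxes.LocalToGlobal.Disproof

/-- Euclidean 3-space. -/
abbrev E3 := EuclideanSpace ℝ (Fin 3)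

/-- The route's range-2 truncation `V_χ = χ·V_LJ`, `χ(r) = min(1, max(0, 4 − 2r))` (syntactically the
lambda inlined in `TruncatedCensusGap`). -/
def Vchi (r : ℝ) : ℝ := min 1 (max 0 (4 - 2 * r)) * lennardJones r

/-- `e* = ⨅_Q e_LJ(Q)` over periodic configurations (a conditionally complete `iInf` on `ℝ`). -/
def eStar : ℝ := ⨅ Q : PeriodicConfiguration 3, Q.energyPerParticle lennardJones

/-- `e_χ* = ⨅_Q e_χ(Q)`. -/
def eChiStar : ℝ := ⨅ Q : PeriodicConfiguration 3, Q.energyPerParticle Vchi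

/-- number of charged (= not charge-free at tolerance `1/100`) sites. -/
def chargedCount {N : ℕ} (y : Fin N → E3) : ℕ :=
  Nat.card {i : Fin N // ¬ IsChargeFree (1 / 100 : ℝ) y i}

/-! ## §0 Reading the crux back (definitional) -/

theorem truncatedCensusGap_iff :
    TruncatedCensusGap ↔ ∃ κ : ℝ, 0 < κ ∧ ∀ (N : ℕ) (y : Fin N → E3), Function.Injective y →
      (N : ℝ) * eChiStar + κ * (chargedCount y : ℝ) ≤ interactionEnergy Vchi y := Iff.rfl

theorem chargedEnergyGap_iff :
    ChargedEnergyGap ↔ ∃ κ C : ℝ, 0 < κ ∧ ∀ (N : ℕ) (y : Fin N → E3), Function.Injective y →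
      (N : ℝ) * eStar + κ * (chargedCount y : ℝ) - C * (N : ℝ) ^ (2 / 3 : ℝ) ≤
        interactionEnergy lennardJones y := Iff.rfl

theorem localToGlobal_iff : LocalToGlobal ↔ (TruncatedCensusGap → ChargedEnergyGap) := Iff.rfl

/-! ## §1 Logic: the crux is a material implication between two open sibling cruxes -/

/-- The consequent alone proves the crux. -/
theorem localToGlobal_of_chargedEnergyGap (h : ChargedEnergyGap) : LocalToGlobal := fun _ => h

/-- A refutation of the antecedent alone proves the crux (vacuously). -/
theorem localToGlobal_of_not_truncatedCensusGap (h : ¬ TruncatedCensusGap) : LocalToGlobal :=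
  fun hT => (h hT).elim

/-- **Why no Lean kill is possible by construction**: `¬ LocalToGlobal` is EQUIVALENT to proving the
XL-open antecedent AND refuting the open consequent. -/
theorem not_localToGlobal_iff : ¬ LocalToGlobal ↔ TruncatedCensusGap ∧ ¬ ChargedEnergyGap :=
  Classical.not_imp

/-! ## §2 Junk audit of the potential -/

theorem Vchi_zero : Vchi 0 = 0 := by simp [Vchi, lennardJones]

theorem Vchi_one : Vchi 1 = -1 / 12 := by norm_num [Vchi, lennardJones]

theorem lennardJones_zero' : lennardJones 0 = 0 := by simp [lennardJones]

/-- `V_LJ(d) ≤ -1/768` for `1 ≤ d ≤ 2`: a crude negative ceiling on the first two shells' worth of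
distances (`V = u²/12 − u/6 ≤ −u/12` with `u = d⁻⁶ ∈ [1/64, 1]`). -/
theorem lennardJones_le_of_mem_Icc {d : ℝ} (h1 : 1 ≤ d) (h2 : d ≤ 2) :
    lennardJones d ≤ -1 / 768 := by
  have hd : 0 < d := by linarith
  set u : ℝ := (d⁻¹) ^ 6 with hu
  have hu0 : 0 ≤ d⁻¹ := by positivity
  have hu1 : u ≤ 1 := by
    have : d⁻¹ ≤ 1 := inv_le_one_of_one_le₀ h1
    exact pow_le_one₀ hu0 this
  have hu2 : 1 / 64 ≤ u := by
    have : (1 / 2 : ℝ) ≤ d⁻¹ := by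
      rw [one_div, inv_le_inv₀ (by norm_num) hd]; exact h2
    calc (1 / 64 : ℝ) = (1 / 2) ^ 6 := by norm_num
      _ ≤ u := pow_le_pow_left₀ (by norm_num) this 6
  have h12 : (d⁻¹) ^ 12 = u ^ 2 := by rw [hu]; ring
  unfold lennardJones
  rw [h12]
  nlinarith [hu1, hu2, sq_nonneg u]


/-! ## §3 LOAD-BEARING: `Function.Injective` (two coincident stacks) -/

/-- the unit vector `e₀`. -/
def e0 : E3 := EuclideanSpace.single 0 1

@[simp] theorem norm_e0 : ‖e0‖ = 1 := by simp [e0]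

theorem e0_ne_zero : e0 ≠ 0 := by
  intro h; have := norm_e0; rw [h, norm_zero] at this; exact zero_ne_one this

/-- TWO STACKS: `m` points at the origin and `m` points at `e₀` (not injective for `m ≥ 2`). -/
def twoStacks (m : ℕ) : Fin (m + m) → E3 :=
  Fin.append (fun _ : Fin m => (0 : E3)) (fun _ : Fin m => e0)

theorem interactionEnergy_const (V : ℝ → ℝ) (hV : V 0 = 0) (m : ℕ) (p : E3) :
    interactionEnergy V (fun _ : Fin m => p) = 0 := by
  unfold interactionEnergy
  simp [hV]

/-- The energy of the two stacks is `m² · V 1` whenever `V 0 = 0` (coincident pairs are free). -/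
theorem interactionEnergy_twoStacks (V : ℝ → ℝ) (hV : V 0 = 0) (m : ℕ) :
    interactionEnergy V (twoStacks m) = (m : ℝ) ^ 2 * V 1 := by
  unfold twoStacks
  rw [interactionEnergy_append V hV, interactionEnergy_const V hV, interactionEnergy_const V hV]
  simp [dist_eq_norm]
  ring

/-- `ChargedEnergyGap` with the hypothesis `Function.Injective y` dropped. -/
def ChargedEnergyGapWithoutInjective : Prop :=
  ∃ κ C : ℝ, 0 < κ ∧ ∀ (N : ℕ) (y : Fin N → E3),
    (N : ℝ) * eStar + κ * (chargedCount y : ℝ) - C * (N : ℝ) ^ (2 / 3 : ℝ) ≤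
      interactionEnergy lennardJones y

/-- `TruncatedCensusGap` with the hypothesis `Function.Injective y` dropped. -/
def TruncatedCensusGapWithoutInjective : Prop :=
  ∃ κ : ℝ, 0 < κ ∧ ∀ (N : ℕ) (y : Fin N → E3),
    (N : ℝ) * eChiStar + κ * (chargedCount y : ℝ) ≤ interactionEnergy Vchi y

/-- Arithmetic core: a priced gap with ANY constants `e, C` and any non-negative price term fails on the
two stacks for `m` large, because their energy `-m²/12` is super-extensive. -/
theorem twoStacks_violate (V : ℝ → ℝ) (hV0 : V 0 = 0) (hV1 : V 1 = -1 / 12) (e C : ℝ) :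
    ∃ m : ℕ, ∀ P : ℝ, 0 ≤ P →
      ¬ (((m + m : ℕ) : ℝ) * e + P - C * ((m + m : ℕ) : ℝ) ^ (2 / 3 : ℝ) ≤
          interactionEnergy V (twoStacks m)) := by
  set B : ℝ := |e| + |C| with hB
  refine ⟨⌈24 * B⌉₊ + 1, fun P hP hle => ?_⟩
  set m : ℕ := ⌈24 * B⌉₊ + 1 with hm
  have hmB : 24 * B < m := by
    have h1 : 24 * B ≤ ⌈24 * B⌉₊ := Nat.le_ceil _
    have h2 : ((⌈24 * B⌉₊ + 1 : ℕ) : ℝ) = ⌈24 * B⌉₊ + 1 := by push_cast; ring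
    rw [hm, h2]; linarith
  have hm1 : (1 : ℝ) ≤ m := by
    have h0 : (0 : ℝ) ≤ (⌈24 * B⌉₊ : ℝ) := Nat.cast_nonneg _
    rw [hm]; push_cast; linarith
  rw [interactionEnergy_twoStacks V hV0, hV1] at hle
  have hN : ((m + m : ℕ) : ℝ) = 2 * m := by push_cast; ring
  rw [hN] at hle
  have hpow : (2 * (m : ℝ)) ^ (2 / 3 : ℝ) ≤ 2 * m := by
    have h := Real.rpow_le_rpow_of_exponent_le (x := 2 * (m : ℝ)) (by linarith)
      (show (2 / 3 : ℝ) ≤ 1 by norm_num)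
    rwa [Real.rpow_one] at h
  have hpow0 : 0 ≤ (2 * (m : ℝ)) ^ (2 / 3 : ℝ) := by positivity
  have hC : C * (2 * (m : ℝ)) ^ (2 / 3 : ℝ) ≤ |C| * (2 * m) := by
    have h1 : C * (2 * (m : ℝ)) ^ (2 / 3 : ℝ) ≤ |C| * (2 * (m : ℝ)) ^ (2 / 3 : ℝ) :=
      mul_le_mul_of_nonneg_right (le_abs_self C) hpow0
    have h2 : |C| * (2 * (m : ℝ)) ^ (2 / 3 : ℝ) ≤ |C| * (2 * (m : ℝ)) :=
      mul_le_mul_of_nonneg_left hpow (abs_nonneg C)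
    linarith
  have he : -(|e| * (2 * m)) ≤ 2 * (m : ℝ) * e := by
    have h1 : (-|e|) * (2 * (m : ℝ)) ≤ e * (2 * (m : ℝ)) :=
      mul_le_mul_of_nonneg_right (neg_abs_le e) (by positivity)
    linarith
  -- from `hle`: 2 m e + P - C (2m)^(2/3) ≤ m² (-1/12)
  have key : (m : ℝ) ^ 2 / 12 ≤ 2 * m * B := by rw [hB]; linarith
  have hm0 : (0 : ℝ) < m := by linarith
  have : (m : ℝ) ≤ 24 * B := by
    by_contra hcon
    push Not at hcon
    nlinarith
  linarith

/-- **Any proof of `ChargedEnergyGap` uses distinctness quantitatively**: without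
`Function.Injective` the priced gap fails for every `κ > 0`, every `C` and EVERY value of the periodic
infimum `e*` (junk or not) — `m + m` points, `m` at `0` and `m` at `e₀`, have Lennard-Jones energy
`-m²/12` because `V_LJ 0 = 0` (`0⁻¹ = 0`). -/
theorem chargedEnergyGap_false_without_injective : ¬ ChargedEnergyGapWithoutInjective := by
  rintro ⟨κ, C, hκ, h⟩
  obtain ⟨m, hm⟩ := twoStacks_violate lennardJones (by simp [lennardJones]) lennardJones_one eStar C
  exact hm _ (by positivity) (h (m + m) (twoStacks m))

/-- The same for the antecedent (also certified, in another form, by the sibling seat's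
`Cruxes/TruncatedCensusGap/Disproof.lean`, `not_gapAtWithoutInjective`). -/
theorem truncatedCensusGap_false_without_injective : ¬ TruncatedCensusGapWithoutInjective := by
  rintro ⟨κ, hκ, h⟩
  obtain ⟨m, hm⟩ := twoStacks_violate Vchi Vchi_zero Vchi_one eChiStar 0
  have h' := h (m + m) (twoStacks m)
  exact hm (κ * (chargedCount (twoStacks m) : ℝ)) (by positivity) (by simpa using h')


/-! ## §4 Gauge-covariant transfers leak at low-angle TWIST walls (new in gen 2)

Every round-1 idea for this crux consumes the antecedent `A = TruncatedCensusGap` on an IMAGE of `y`: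
a dilate (`scale-free-shape-transfer`: `RelativeCoercivity`), a piecewise near-similarity
(`cut-and-adapt-envelope`: `CutAndAdaptDomination`), a piecewise uniaxial "criticality-matching gauge"
(`criticality-matching-gauge`: Claim G).  All need a DOMINATION inequality with a configuration-uniform
constant, schematically `Exc_LJ(y) + C N^{2/3} ≥ c · [E_χ(G_y y) − N e_χ* + cut penalties]`.

OBSTRUCTION (paper; kernel certified below).  Because `V_LJ` and `V_χ` relax hcp to DIFFERENT `c/a`
(relative mismatch `α ≈ 8.25e-4`, ideator-3 kit j005755), the zero-misfit gauge on an hcp grain with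
`c`-axis `c` is the well `SO(3) · U_{α,c}`, `U_{α,c} = 1 + α c ⊗ c` (up to a dilation).  Across a grain
boundary where `c` jumps from `c₋` to `c₊` (rotation by `2θ_m` about an axis `ω`), a CONTINUOUS gauge
needs a rank-one connection `Q U₊ − U₋ = a ⊗ n` across the wall normal `n` (Hadamard).  By the
twinning equation this exists iff `n` is one of the two twin normals, which are `⊥ ω` (TILT walls);
for a TWIST wall (`n = ω`) there is none: `no_rankOne_connection_twist`.  A twist-wall bicrystal
laminate (misorientation `θ_m`, spacing `ℓ`) therefore forces on the gauge side, per site, at least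
`min(cut price/ℓ, K' α² θ_m² / 2, m_χ)` (cut the charge-free wall; or leave a volume misfit strain
`α θ_m`; or do not adapt), while Lennard-Jones pays only the wall energy `≈ μ b θ_m |log θ_m| / ℓ` per
site (screw-dislocation grids, Read–Shockley) — and THAT ratio is unbounded as `θ_m → 0`, `ℓ → ∞`
(`ℓ θ_m α²` large).  Low-angle walls are charge-free except at dislocation cores (core tubes of radius
`≈ b/(2π · 1 %) ≈ 16 b`, a fraction `∝ θ_m` of the wall sites), so neither "cut only along charged
walls" (criticality-matching-gauge) nor "β per interface site" (cut-and-adapt) can follow them for free.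
CONSEQUENCE: no gauge-covariant consumption of `A` with a uniform constant proves the crux; the constant
must degrade with the local misorientation content of `y`, i.e. the proof must price low-angle twist
walls by LENNARD-JONES elasticity directly — at which point `A` is a template, not a hypothesis (as the
flux-cell card already concedes).  Uncertified inputs: (U1) constructive LJ upper bound for twist walls,
(U2) hcp common minimiser with `α ≠ 0` (for an fcc/cubic common minimiser the obstruction disappears:
similarities exhaust the moduli), (U3) rigidity lower bound for the misfit.  What IS certified is the
algebraic kernel: -/

/-- coordinate unit vectors. -/
def ee (i : Fin 3) : E3 := EuclideanSpace.single i 1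

/-- the uniaxial stretch `U_{α,c} v = v + α ⟪c, v⟫ c` (for a unit vector `c`: eigenvalue `1 + α` along `c`,
`1` across) — the linear part of the gauge that converts the LJ-relaxed hcp cell into the `V_χ`-relaxed one
along the local `c`-axis (`α ≈ 8.25e-4`, ideator-3 kit j005755; `8.4e-4`, ideator 1). -/
def uniax (α : ℝ) (c v : E3) : E3 := v + (α * ⟪c, v⟫) • c

/-- the two `c`-axes of a bicrystal: `c± = p e₀ ± q e₂`, rotated against each other about the axis `e₁`. -/
def cPlus (p q : ℝ) : E3 := p • ee 0 + q • ee 2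
def cMinus (p q : ℝ) : E3 := p • ee 0 - q • ee 2

@[simp] theorem inner_ee (i j : Fin 3) : ⟪ee i, ee j⟫ = if i = j then (1 : ℝ) else 0 := by
  by_cases h : i = j
  · subst h; simp [ee]
  · simp [ee, h, EuclideanSpace.inner_single_left]

/-- **Twist-wall incompatibility (Hadamard / twinning equation).**  For the two uniaxially adapted wells
`U₊ = U_{α,c₊}`, `U₋ = U_{α,c₋}` of a bicrystal whose `c`-axis is rotated about `e₁` across the wall,
there is NO rank-one connection `Q U₊ − U₋ = a ⊗ e₁` with `Q` a linear isometry when the wall normal is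
the rotation axis `e₁` (a TWIST wall): testing on `e₀, e₂ ⊥ e₁` forces `Q U₊ e₀ = U₋ e₀`,
`Q U₊ e₂ = U₋ e₂`, and isometries preserve `⟪U₊e₀, U₊e₂⟫ = +pq(2α + α²(p²+q²)) ≠ ⟪U₋e₀, U₋e₂⟫ = −(…)`.
(For the TILT normals `e₀`, `e₂` a rank-one connection DOES exist — `ω = ±α sin 2θ` solves the
linearised twinning equation — so tilt walls do not obstruct; see the section docblock for the
energy scaling that turns this kernel into a counterexample family for gauge-covariant transfers.) -/
theorem no_rankOne_connection_twist {α p q : ℝ} (hα : 0 < α) (hp : 0 < p) (hq : 0 < q) :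
    ¬ ∃ (Q : E3 →ₗᵢ[ℝ] E3) (a : E3), ∀ v : E3,
        Q (uniax α (cPlus p q) v) - uniax α (cMinus p q) v = ⟪ee 1, v⟫ • a := by
  rintro ⟨Q, a, h⟩
  have h0 := h (ee 0)
  have h2 := h (ee 2)
  simp only [inner_ee] at h0 h2
  simp at h0 h2
  -- h0 : Q (U₊ e₀) = U₋ e₀, h2 : Q (U₊ e₂) = U₋ e₂ (as differences = 0)
  have e0 : Q (uniax α (cPlus p q) (ee 0)) = uniax α (cMinus p q) (ee 0) := sub_eq_zero.1 h0
  have e2 : Q (uniax α (cPlus p q) (ee 2)) = uniax α (cMinus p q) (ee 2) := sub_eq_zero.1 h2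
  have key : ⟪uniax α (cPlus p q) (ee 0), uniax α (cPlus p q) (ee 2)⟫ =
      ⟪uniax α (cMinus p q) (ee 0), uniax α (cMinus p q) (ee 2)⟫ := by
    rw [← e0, ← e2, LinearIsometry.inner_map_map]
  simp only [uniax, cPlus, cMinus, inner_add_left, inner_add_right, inner_sub_left, inner_sub_right,
    inner_smul_left, inner_smul_right, inner_ee] at key
  simp at key
  nlinarith [mul_pos hp hq, mul_pos (mul_pos hα hp) hq, sq_nonneg p, sq_nonneg q,
    mul_pos (mul_pos hα hα) (mul_pos hp hq)]


@[simp] theorem norm_ee (i : Fin 3) : ‖ee i‖ = 1 := by simp [ee]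

/-- **Quantitative twist-wall incompatibility**: the two uniaxially adapted wells are not only
rank-one disconnected across the twist normal `e₁`, they are UNIFORMLY far apart: if a linear isometry
`Q` matches `U₊e₀` to `U₋e₀` and `U₊e₂` to `U₋e₂` up to errors `d₀, d₂` of norm `≤ ε ≤ 1`, then
`ε ≥ 4αpq/7` (for `α, p, q ∈ (0, 1]`; with `p = cos θ_m`, `q = sin θ_m` this is the misfit strain
`g ≳ (4/7) α sin 2θ_m / 2` per unit length that §4's scaling argument charges to the gauge side as a
VOLUME term). -/
theorem twist_wells_gap {α p q ε : ℝ} (hα : 0 < α) (hα1 : α ≤ 1) (hp : 0 < p) (hp1 : p ≤ 1)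
    (hq : 0 < q) (hq1 : q ≤ 1) (hε1 : ε ≤ 1) (Q : E3 →ₗᵢ[ℝ] E3) (d0 d2 : E3)
    (h0 : Q (uniax α (cPlus p q) (ee 0)) = uniax α (cMinus p q) (ee 0) + d0)
    (h2 : Q (uniax α (cPlus p q) (ee 2)) = uniax α (cMinus p q) (ee 2) + d2)
    (hd0 : ‖d0‖ ≤ ε) (hd2 : ‖d2‖ ≤ ε) : 4 * α * p * q / 7 ≤ ε := by
  set x0 := uniax α (cPlus p q) (ee 0) with hx0
  set x2 := uniax α (cPlus p q) (ee 2) with hx2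
  set y0 := uniax α (cMinus p q) (ee 0) with hy0
  set y2 := uniax α (cMinus p q) (ee 2) with hy2
  have Sx : ⟪x0, x2⟫ = p * q * (2 * α + α ^ 2 * (p ^ 2 + q ^ 2)) := by
    simp only [hx0, hx2, uniax, cPlus, inner_add_left, inner_add_right, inner_smul_left,
      inner_smul_right, inner_ee]
    simp; ring
  have Sy : ⟪y0, y2⟫ = -(p * q * (2 * α + α ^ 2 * (p ^ 2 + q ^ 2))) := by
    simp only [hy0, hy2, uniax, cMinus, inner_add_left, inner_add_right, inner_sub_left,
      inner_sub_right, inner_smul_left, inner_smul_right, inner_ee]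
    simp; ring
  have key : ⟪x0, x2⟫ = ⟪y0, y2⟫ + ⟪y0, d2⟫ + ⟪d0, y2⟫ + ⟪d0, d2⟫ := by
    rw [← Q.inner_map_map x0 x2, h0, h2]
    simp only [inner_add_left, inner_add_right]
    ring
  -- norm bounds on the concrete vectors
  have hcM : ‖cMinus p q‖ ≤ 2 := by
    calc ‖cMinus p q‖ ≤ ‖p • ee 0‖ + ‖q • ee 2‖ := norm_sub_le _ _
      _ = p + q := by rw [norm_smul, norm_smul, norm_ee, norm_ee, Real.norm_eq_abs,
            Real.norm_eq_abs, abs_of_pos hp, abs_of_pos hq]; ring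
      _ ≤ 2 := by linarith
  have hin0 : ⟪cMinus p q, ee 0⟫ = p := by
    simp only [cMinus, inner_sub_left, inner_smul_left, inner_ee]; simp
  have hin2 : ⟪cMinus p q, ee 2⟫ = -q := by
    simp only [cMinus, inner_sub_left, inner_smul_left, inner_ee]; simp
  have hy0n : ‖y0‖ ≤ 3 := by
    rw [hy0, uniax, hin0]
    calc ‖ee 0 + (α * p) • cMinus p q‖ ≤ ‖ee 0‖ + ‖(α * p) • cMinus p q‖ := norm_add_le _ _
      _ = 1 + α * p * ‖cMinus p q‖ := by
          rw [norm_ee, norm_smul, Real.norm_eq_abs, abs_of_pos (mul_pos hα hp)]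
      _ ≤ 3 := by nlinarith [mul_pos hα hp, norm_nonneg (cMinus p q)]
  have hy2n : ‖y2‖ ≤ 3 := by
    rw [hy2, uniax, hin2]
    calc ‖ee 2 + (α * -q) • cMinus p q‖ ≤ ‖ee 2‖ + ‖(α * -q) • cMinus p q‖ := norm_add_le _ _
      _ = 1 + α * q * ‖cMinus p q‖ := by
          rw [norm_ee, norm_smul, Real.norm_eq_abs, show α * -q = -(α * q) by ring, abs_neg,
            abs_of_pos (mul_pos hα hq)]
      _ ≤ 3 := by nlinarith [mul_pos hα hq, norm_nonneg (cMinus p q)]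
  have hε0 : 0 ≤ ε := (norm_nonneg d0).trans hd0
  have b1 : ⟪y0, d2⟫ ≤ 3 * ε :=
    (real_inner_le_norm _ _).trans (by nlinarith [norm_nonneg d2, norm_nonneg y0])
  have b2 : ⟪d0, y2⟫ ≤ 3 * ε :=
    (real_inner_le_norm _ _).trans (by nlinarith [norm_nonneg d0, norm_nonneg y2])
  have b3 : ⟪d0, d2⟫ ≤ ε :=
    (real_inner_le_norm _ _).trans (by nlinarith [norm_nonneg d0, norm_nonneg d2])
  have hΔ : 4 * α * p * q ≤ 2 * (p * q * (2 * α + α ^ 2 * (p ^ 2 + q ^ 2))) := by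
    nlinarith [mul_pos hp hq, mul_pos (mul_pos hα hα) (mul_pos hp hq), sq_nonneg p, sq_nonneg q]
  rw [Sx, Sy] at key
  nlinarith [key, b1, b2, b3, hΔ]


/-! ## §5 Card first-lemma audit (round-1 idea `cut-and-adapt-envelope`, `SketchIdeator1.lean`)

The sketch module is a crux workfile and is not built on the farm, so its statements are COPIED
verbatim here (namespace `Disproof.CutAndAdapt`); any drift of the card must be re-copied. -/

namespace CutAndAdapt

/-- verbatim copy of `…Cruxes.LocalToGlobal.CutAndAdapt.IsNearSimilarity` (SketchIdeator1.lean). -/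
def IsNearSimilarity (θ : ℝ) (φ : E3 → E3) : Prop :=
  ContDiff ℝ 2 φ ∧ ∀ x : E3, ∃ l : ℝ, 0 < l ∧
    ‖fderiv ℝ φ x - l • ContinuousLinearMap.id ℝ E3‖ ≤ θ * l ∧ ‖fderiv ℝ (fderiv ℝ φ) x‖ ≤ θ * l

/-- verbatim copy of `…CutAndAdapt.WeakFarField` (SketchIdeator1.lean): "any set of sites has
half-pair excess `≥ −C` per boundary site". -/
def WeakFarField : Prop :=
  ∃ C : ℝ, ∀ (N : ℕ) (y : Fin N → E3), Function.Injective y → ∀ U : Finset (Fin N),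
    -(C * (Nat.card {i : Fin N // i ∈ U ∧ ∃ j : Fin N, j ∉ U ∧ dist (y j) (y i) ≤ 4 * nearestDist y i} : ℝ)) ≤
      ∑ i ∈ U, ((1 / 2 : ℝ) * (∑ j ∈ Finset.univ.erase i, lennardJones (dist (y i) (y j))) - eStar)

/-- verbatim copy of `…CutAndAdapt.FragileChargePricing` (SketchIdeator1.lean). -/
def FragileChargePricing : Prop :=
  ∃ θ κf C : ℝ, 0 < θ ∧ 0 < κf ∧ ∀ (N : ℕ) (y : Fin N → E3), Function.Injective y →
    ∀ Ω : Finset (Fin N),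
      (∀ i ∈ Ω, ∃ φ : E3 → E3, IsNearSimilarity θ φ ∧ IsChargeFree (1 / 100 : ℝ) (φ ∘ y) i) →
        κf * (Nat.card {i : Fin N // i ∈ Ω ∧ ¬ IsChargeFree (1 / 100 : ℝ) y i} : ℝ) -
            C * (Nat.card {i : Fin N // i ∈ Ω ∧ ∃ j : Fin N, j ∉ Ω ∧
                  dist (y j) (y i) ≤ 4 * nearestDist y i} : ℝ) ≤
          ∑ i ∈ Ω, ((1 / 2 : ℝ) * (∑ j ∈ Finset.univ.erase i, lennardJones (dist (y i) (y j))) - eStar)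

/-- verbatim copy of `…CutAndAdapt.adapt` (SketchIdeator1.lean). -/
def adapt {N : ℕ} (σ : Fin N → ℕ) (φ : ℕ → E3 → E3) (y : Fin N → E3) : Fin N → E3 :=
  fun i => φ (σ i) (y i)

/-- verbatim copy of `…CutAndAdapt.interfaceCount` (SketchIdeator1.lean). -/
def interfaceCount {N : ℕ} (w : ℝ) (σ : Fin N → ℕ) (y : Fin N → E3) : ℕ :=
  Nat.card {i : Fin N // ∃ j : Fin N, σ j ≠ σ i ∧ dist (y i) (y j) ≤ w * nearestDist y i}

/-- verbatim copy of `…CutAndAdapt.CutAndAdaptDomination` (SketchIdeator1.lean), the card's FIRST LEMMA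
("TL").  VERDICT (gen 2, on paper — NOT certifiable in Lean because `e*` sits on the favourable side):
**false for every choice of `θ, w, β, c, C`**, witnessed by hcp(a*) bicrystal LAMINATES with alternating
low-angle TWIST walls (rotation axis = wall normal, `⊥ c`), misorientation `θ_m` and wall spacing `ℓ`:
the Lennard-Jones excess per site is `≲ μ b θ_m |log θ_m| / ℓ + C/L` (dislocation walls; (U1) below),
while after ANY class assignment and ANY near-similarities the left side per site is
`≥ c · min(β/ℓ, K'α²θ_m²/2, m_χ)` — cut every wall, or leave the two uniaxially adapted wells
unmatched across the walls (`no_rankOne_connection_twist`: they have no rank-one connection, so the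
mismatch `α θ_m` is a VOLUME strain in `E_χ(adapt σ φ y)`, (U3)), or do not adapt the `c/a` anisotropy at
all (sliver `m_χ` per site, ideators' mismatch lemma).  Choosing `θ_m` so small that
`μ b θ_m |log θ_m| < c β / 4` (the cut option loses), then
`ℓ > 4 μ b |log θ_m| · max(1/(c K' α² θ_m), θ_m/(c m_χ))` (the misfit and no-adaptation options lose),
then `L ≫ ℓ` (the `C N^{2/3}` slack loses), violates the inequality.  Tilt walls do NOT work (rank-one compatible via the twinning
equation).  Uncertified inputs: (U1) Read–Shockley-type constructive upper bound for LJ hcp twist walls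
(⟨a⟩ + ⟨c⟩ screw grids); (U2) hcp is the common minimiser type of `V_LJ` and `V_χ` with `c/a` mismatch
`α ≈ 8.25e-4 ≠ 0` (kit j005755 of ideator 3; 8.4e-4 ideator 1; for a CUBIC common minimiser the
obstruction vanishes); (U3) FJM-type rigidity lower bound for the gauge misfit.  Numbers (α = 8.25e-4,
K' ≈ 5.4, m_χ = 1.85e-6, c ≤ 0.29, and β = κ_A ≤ 2.7e-5 as the composition with
`RobustChargeViaCensus` requires — for the bare statement any β > 0 meets the same fate):
`θ_m ~ 5e-7`, `ℓ ~ 1e12` lattice spacings — astronomically large but legitimate witnesses of a `∀ N`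
statement. -/
def CutAndAdaptDomination : Prop :=
  ∃ θ w β c C : ℝ, 0 < θ ∧ 3 ≤ w ∧ 0 < β ∧ 0 < c ∧
    ∀ (N : ℕ) (y : Fin N → E3), Function.Injective y →
      ∃ (σ : Fin N → ℕ) (φ : ℕ → E3 → E3), (∀ k, IsNearSimilarity θ (φ k)) ∧
        Function.Injective (adapt σ φ y) ∧
        c * (interactionEnergy Vchi (adapt σ φ y) + β * (interfaceCount w σ y : ℝ) - (N : ℝ) * eChiStar) ≤
          interactionEnergy lennardJones y - (N : ℝ) * eStar + C * (N : ℝ) ^ (2 / 3 : ℝ)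

/-- verbatim copy of `…CutAndAdapt.robustChargedCount` (SketchIdeator1.lean). -/
def robustChargedCount {N : ℕ} (θ : ℝ) (y : Fin N → E3) : ℕ :=
  Nat.card {i : Fin N // ∀ φ : E3 → E3, IsNearSimilarity θ φ → ¬ IsChargeFree (1 / 100 : ℝ) (φ ∘ y) i}

/-- The INNER statement of `…CutAndAdapt.RobustChargeViaCensus` (SketchIdeator1.lean), i.e. the card's
"bookkeeping" step with its antecedent `TruncatedCensusGap →` removed (verbatim otherwise).  VERDICT
(gen 2, paper): **false, by TELEPORTED VACANCY FILLING** — `y` = an `L`-block of the `V_χ`-optimal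
crystal with a density-`ν` periodic pattern of vacancies, PLUS a far-away translate of the vacancy
pattern (class 1); `φ₀ = id`, `φ₁` = the translation carrying class 1 exactly into the vacancies.
Then `adapt σ φ y` is the PERFECT block (injective), `interfaceCount w σ y = 0` (class 1 is farther
than `w·nn` from class 0, and its own `nn` is the pattern spacing), while the `12νN` vacancy neighbours
(11 bonds each) and the `νN` far points are ROBUSTLY charged in `y` (a `θ ≤ 1/1000` near-similarity
moves distance ratios by `≤ 0.2 %`, it cannot create a twelfth bond).  The inequality would give
`e_χ(Q_block) − e_χ* ≥ 13κν − O(L⁻¹)` for the optimal `Q`: false.  ROOT CAUSE / REPAIR: `interfaceCount`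
is read in `y` only; the cut penalty must also see interfaces of the IMAGE (classes whose images come
within `w·nn` of each other), or the maps of distinct classes must be required to keep their images
`≥ w·nn` apart.  OBSTRUCTION TO CERTIFYING: the favourable side again (`e_χ*` must be pinned to the
explicit crystal: a periodic-infimum lower bound), and the minimising `Q` is not known to be hcp. -/
def RobustChargeViaCensusInner : Prop :=
  ∀ θ : ℝ, 0 < θ → θ ≤ 1 / 1000 → ∃ κ : ℝ, 0 < κ ∧ ∀ (w β : ℝ), 3 ≤ w → κ ≤ β →
    ∀ (N : ℕ) (y : Fin N → E3) (σ : Fin N → ℕ) (φ : ℕ → E3 → E3), (∀ k, IsNearSimilarity θ (φ k)) →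
      Function.Injective (adapt σ φ y) →
        (N : ℝ) * eChiStar + κ * (robustChargedCount θ y : ℝ) ≤
          interactionEnergy Vchi (adapt σ φ y) + β * (interfaceCount w σ y : ℝ)

end CutAndAdapt

/-! ### The collinear crowd: site `0` at the origin, sites `1 … M` at `(1 + k/(M+1))·e₀` -/

/-- coefficient of the `k`-th crowd point along `e₀`. -/
def crowdCoeff (M : ℕ) (k : Fin (M + 1)) : ℝ :=
  if (k : ℕ) = 0 then 0 else 1 + (k : ℝ) / (M + 1)

/-- THE CROWD: `M + 1` distinct collinear points, `M` of them at distances in `(1, 2)` from site `0`. -/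
def crowd (M : ℕ) : Fin (M + 1) → E3 := fun k => crowdCoeff M k • e0

theorem crowdCoeff_zero (M : ℕ) : crowdCoeff M 0 = 0 := by simp [crowdCoeff]

theorem crowdCoeff_of_ne {M : ℕ} {k : Fin (M + 1)} (hk : k ≠ 0) :
    crowdCoeff M k = 1 + (k : ℝ) / (M + 1) := by
  have : (k : ℕ) ≠ 0 := fun h => hk (Fin.ext h)
  simp [crowdCoeff, this]

theorem one_lt_crowdCoeff {M : ℕ} {k : Fin (M + 1)} (hk : k ≠ 0) : 1 < crowdCoeff M k := by
  rw [crowdCoeff_of_ne hk]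
  have : (k : ℕ) ≠ 0 := fun h => hk (Fin.ext h)
  have hk' : (0 : ℝ) < (k : ℕ) := by exact_mod_cast Nat.pos_of_ne_zero this
  have hM : (0 : ℝ) < (M : ℝ) + 1 := by positivity
  have : (0 : ℝ) < ((k : ℕ) : ℝ) / (M + 1) := div_pos hk' hM
  linarith

theorem crowdCoeff_le_two {M : ℕ} (k : Fin (M + 1)) : crowdCoeff M k ≤ 2 := by
  by_cases hk : k = 0
  · rw [hk, crowdCoeff_zero]; norm_num
  rw [crowdCoeff_of_ne hk]
  have hM : (0 : ℝ) < (M : ℝ) + 1 := by positivity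
  have hkM : ((k : ℕ) : ℝ) ≤ (M : ℝ) + 1 := by
    have := k.2
    exact_mod_cast this.le
  have : ((k : ℕ) : ℝ) / (M + 1) ≤ 1 := by rwa [div_le_one hM]
  linarith

theorem crowdCoeff_injective (M : ℕ) : Function.Injective (crowdCoeff M) := by
  intro a b hab
  by_cases ha : a = 0 <;> by_cases hb : b = 0
  · rw [ha, hb]
  · exfalso
    have h1 := one_lt_crowdCoeff (M := M) hb
    rw [← hab, ha, crowdCoeff_zero] at h1
    linarith
  · exfalso
    have h1 := one_lt_crowdCoeff (M := M) ha
    rw [hab, hb, crowdCoeff_zero] at h1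
    linarith
  · rw [crowdCoeff_of_ne ha, crowdCoeff_of_ne hb] at hab
    have hM : (M : ℝ) + 1 ≠ 0 := by positivity
    have : ((a : ℕ) : ℝ) = ((b : ℕ) : ℝ) := by
      field_simp at hab
      linarith
    exact Fin.ext (by exact_mod_cast this)

theorem crowd_injective (M : ℕ) : Function.Injective (crowd M) := fun _ _ hab =>
  crowdCoeff_injective M (smul_left_injective ℝ e0_ne_zero hab)

theorem dist_crowd_zero {M : ℕ} (k : Fin (M + 1)) :
    dist (crowd M 0) (crowd M k) = crowdCoeff M k := by
  have h0 : crowd M 0 = 0 := by simp [crowd, crowdCoeff_zero]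
  rw [h0, dist_comm, dist_zero_right, crowd, norm_smul, norm_e0, mul_one, Real.norm_eq_abs,
    abs_of_nonneg]
  by_cases hk : k = 0
  · rw [hk, crowdCoeff_zero]
  · exact (one_lt_crowdCoeff hk).le.trans' zero_le_one

/-- every crowd term at site `0` is `≤ -1/768`. -/
theorem lennardJones_dist_crowd_le {M : ℕ} {k : Fin (M + 1)} (hk : k ≠ 0) :
    lennardJones (dist (crowd M 0) (crowd M k)) ≤ -1 / 768 := by
  rw [dist_crowd_zero]
  exact lennardJones_le_of_mem_Icc (one_lt_crowdCoeff hk).le (crowdCoeff_le_two k)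

/-- the half-pair sum at site `0` of the crowd is `≤ -M/768`. -/
theorem sum_crowd_le (M : ℕ) :
    ∑ j ∈ Finset.univ.erase (0 : Fin (M + 1)), lennardJones (dist (crowd M 0) (crowd M j)) ≤
      -(M : ℝ) / 768 := by
  calc ∑ j ∈ Finset.univ.erase (0 : Fin (M + 1)), lennardJones (dist (crowd M 0) (crowd M j))
      ≤ ∑ _j ∈ Finset.univ.erase (0 : Fin (M + 1)), (-1 / 768 : ℝ) :=
        Finset.sum_le_sum fun j hj => lennardJones_dist_crowd_le (Finset.ne_of_mem_erase hj)
    _ = -(M : ℝ) / 768 := by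
        rw [Finset.sum_const, Finset.card_erase_of_mem (Finset.mem_univ _), Finset.card_univ,
          Fintype.card_fin, nsmul_eq_mul]
        push_cast
        ring

/-- **`WeakFarField` (card cut-and-adapt-envelope, companion statement) is FALSE as stated**: the
half-pair site functional `½ Σ_j V_LJ(|y_i − y_j|)` is unbounded below on injective but NON-SEPARATED
configurations — crowd `M` far-but-not-too-far points (distances in `(1, 2]`) around one site. With
`U = {0}` the boundary count is `≤ 1`, so the claimed bound `−C ≤ ½·(−M/768) − e*` fails for
`M > 1536(|C| + |e*|)`, whatever the value of `e*`.  REPAIR (what the card means): add a hard-core /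
minimal-distance hypothesis `∀ i ≠ j, r₀ ≤ dist (y i) (y j)` (provers get it from LJ energetics only for
the WHOLE configuration, by the removal induction, never for a region); then the statement is a
Kepler-type counting bound with `C = C(r₀)`. Classification: misstated (regional statements cannot
inherit separation from global minimality). -/
theorem not_weakFarField : ¬ CutAndAdapt.WeakFarField := by
  rintro ⟨C, h⟩
  set M : ℕ := ⌈1536 * (|C| + |eStar|)⌉₊ + 1 with hM
  have hMlt : 1536 * (|C| + |eStar|) < M := by
    have h1 : 1536 * (|C| + |eStar|) ≤ ⌈1536 * (|C| + |eStar|)⌉₊ := Nat.le_ceil _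
    have h2 : ((⌈1536 * (|C| + |eStar|)⌉₊ + 1 : ℕ) : ℝ) = ⌈1536 * (|C| + |eStar|)⌉₊ + 1 := by
      push_cast; ring
    rw [hM, h2]; linarith
  have key := h (M + 1) (crowd M) (crowd_injective M) {0}
  rw [Finset.sum_singleton] at key
  -- the boundary count is at most one (every element has index `0`)
  have hcard : (Nat.card {i : Fin (M + 1) // i ∈ ({0} : Finset (Fin (M + 1))) ∧
      ∃ j : Fin (M + 1), j ∉ ({0} : Finset (Fin (M + 1))) ∧
        dist (crowd M j) (crowd M i) ≤ 4 * nearestDist (crowd M) i} : ℝ) ≤ 1 := by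
    have hsub : Subsingleton {i : Fin (M + 1) // i ∈ ({0} : Finset (Fin (M + 1))) ∧
        ∃ j : Fin (M + 1), j ∉ ({0} : Finset (Fin (M + 1))) ∧
          dist (crowd M j) (crowd M i) ≤ 4 * nearestDist (crowd M) i} :=
      ⟨fun a b => Subtype.ext ((Finset.mem_singleton.1 a.2.1).trans (Finset.mem_singleton.1 b.2.1).symm)⟩
    exact_mod_cast Finite.card_le_one_iff_subsingleton.2 hsub
  have hC : -|C| ≤ -(C * (Nat.card {i : Fin (M + 1) // i ∈ ({0} : Finset (Fin (M + 1))) ∧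
      ∃ j : Fin (M + 1), j ∉ ({0} : Finset (Fin (M + 1))) ∧
        dist (crowd M j) (crowd M i) ≤ 4 * nearestDist (crowd M) i} : ℝ)) := by
    have h0 : (0 : ℝ) ≤ (Nat.card {i : Fin (M + 1) // i ∈ ({0} : Finset (Fin (M + 1))) ∧
      ∃ j : Fin (M + 1), j ∉ ({0} : Finset (Fin (M + 1))) ∧
        dist (crowd M j) (crowd M i) ≤ 4 * nearestDist (crowd M) i} : ℝ) := Nat.cast_nonneg _
    nlinarith [le_abs_self C, neg_abs_le C, abs_nonneg C]
  have hS := sum_crowd_le M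
  have he := neg_abs_le eStar
  have he' := le_abs_self eStar
  linarith


/-! ## §5b Certified: locality of charge, the first charge-free certificate, and `¬ FragileChargePricing`

Three by-products, the first two POSITIVE and reusable by provers (every card says informally "the charge
status of `i` is determined within `3·nn_i`"; nothing of the kind was in tree):
* `isChargeFree_iff_comp_of_far` — LOCALITY OF CHARGE: sites that neither undercut a sub-family's own
  scales nor bond to `i` can be deleted without changing the charge status of `i`;
* `isChargeFree_fcc13_zero` — the centre of the exact fcc 13-cluster (integer coordinates, scale `√2`)
  IS charge-free at tolerance `1/100` (`decide` on the integer table of squared distances; bonds are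
  exactly the pairs at squared distance 2);
* `not_fragileChargePricing` — the cut-and-adapt card's "fragile charge is elastic" regional statement is
  FALSE as stated (crowding far points around the certified charge-free centre), upgrading the gen-2 v2
  near-miss to a theorem. -/

section Locality

open Set

variable {ι ι' X : Type*} [PseudoMetricSpace X]

/-- Restricting a configuration to a sub-family can only RAISE nearest-neighbour distances (fewer
competitors), provided the sub-family has at least two members. -/
theorem nearestDist_le_nearestDist_comp (y : ι' → X) (e : ι ↪ ι') {k : ι} (hk : ∃ j, j ≠ k) :
    nearestDist y (e k) ≤ nearestDist (y ∘ e) k :=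
  le_nearestDist hk fun _ hj => nearestDist_le_dist y (fun h => hj (e.injective h))

/-- If moreover every site OUTSIDE the sub-family is at least `nn_k` (sub-family scale) away from
`y (e k)`, the two nearest-neighbour distances agree. -/
theorem nearestDist_comp_eq (y : ι' → X) (e : ι ↪ ι') {k : ι} (hk : ∃ j, j ≠ k)
    (H : ∀ j' : ι', j' ∉ range e → nearestDist (y ∘ e) k ≤ dist (y (e k)) (y j')) :
    nearestDist y (e k) = nearestDist (y ∘ e) k := by
  refine le_antisymm (nearestDist_le_nearestDist_comp y e hk) ?_
  obtain ⟨j, hj⟩ := hk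
  refine le_nearestDist ⟨e j, fun h => hj (e.injective h)⟩ fun j' hj' => ?_
  by_cases hr : j' ∈ range e
  · obtain ⟨j, rfl⟩ := hr
    exact nearestDist_le_dist (y ∘ e) fun h => hj' (congrArg e h)
  · exact H j' hr

/-- Under the hypothesis of `nearestDist_comp_eq` at every site of the sub-family, the bond graph of
the sub-family is the pull-back of the bond graph of the whole configuration. -/
theorem bondGraph_comp_eq_comap (y : ι' → X) (e : ι ↪ ι') (η : ℝ) [Nontrivial ι]
    (H : ∀ k : ι, ∀ j' : ι', j' ∉ range e → nearestDist (y ∘ e) k ≤ dist (y (e k)) (y j')) :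
    bondGraph η (y ∘ e) = (bondGraph η y).comap e := by
  ext j k
  have hj := nearestDist_comp_eq y e (exists_ne j) (H j)
  have hk := nearestDist_comp_eq y e (exists_ne k) (H k)
  simp only [SimpleGraph.comap_adj, bondGraph_adj, Function.comp_apply, hj, hk,
    e.injective.ne_iff]

/-- **Locality of charge.**  Let `e : ι ↪ ι'` single out a sub-family (at least two sites) of the
configuration `y`.  If (H1) no site outside the sub-family comes closer to a sub-family site `k` than
`k`'s own sub-family scale `nn_k`, and (H2) no site outside the sub-family is bonded to `e i`, then
`e i` is charge-free in `y` iff `i` is charge-free in the sub-family `y ∘ e`.  (Every bond and every ring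
number entering `IsChargeFree η · i` lives on `i` and its bonded neighbours.) -/
theorem isChargeFree_iff_comp_of_far (y : ι' → X) (e : ι ↪ ι') (η : ℝ) [Nontrivial ι] (i : ι)
    (H1 : ∀ k : ι, ∀ j' : ι', j' ∉ range e → nearestDist (y ∘ e) k ≤ dist (y (e k)) (y j'))
    (H2 : ∀ j' : ι', j' ∉ range e → ¬ (bondGraph η y).Adj (e i) j') :
    IsChargeFree η y (e i) ↔ IsChargeFree η (y ∘ e) i := by
  have hG := bondGraph_comp_eq_comap y e η H1
  -- adjacency inside the sub-family
  have hadj : ∀ j k : ι, (bondGraph η y).Adj (e j) (e k) ↔ (bondGraph η (y ∘ e)).Adj j k := by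
    intro j k; rw [hG, SimpleGraph.comap_adj]
  -- the neighbour set of `e i` is the image of the neighbour set of `i`
  have hN : (bondGraph η y).neighborSet (e i) = e '' (bondGraph η (y ∘ e)).neighborSet i := by
    ext j'
    simp only [SimpleGraph.mem_neighborSet, mem_image]
    constructor
    · intro h
      by_cases hr : j' ∈ range e
      · obtain ⟨j, rfl⟩ := hr
        exact ⟨j, (hadj i j).1 h, rfl⟩
      · exact (H2 j' hr h).elim
    · rintro ⟨j, hj, rfl⟩
      exact (hadj i j).2 hj
  -- common neighbours with a sub-family site
  have hC : ∀ j : ι, (bondGraph η y).neighborSet (e i) ∩ (bondGraph η y).neighborSet (e j) =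
      e '' ((bondGraph η (y ∘ e)).neighborSet i ∩ (bondGraph η (y ∘ e)).neighborSet j) := by
    intro j
    rw [hN, Set.image_inter e.injective]
    ext k'
    simp only [mem_inter_iff, mem_image, SimpleGraph.mem_neighborSet]
    constructor
    · rintro ⟨⟨k, hk, rfl⟩, h2⟩
      exact ⟨⟨k, hk, rfl⟩, ⟨k, (hadj j k).1 h2, rfl⟩⟩
    · rintro ⟨⟨k, hk, rfl⟩, ⟨k₂, hk₂, hkk⟩⟩
      refine ⟨⟨k, hk, rfl⟩, ?_⟩
      rw [← hkk]
      exact (hadj j k₂).2 hk₂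
  have hring : ∀ j : ι, ringNumber η y (e i) (e j) = ringNumber η (y ∘ e) i j := by
    intro j
    rw [ringNumber_def, ringNumber_def, hC j, Set.ncard_image_of_injective _ e.injective]
  rw [isChargeFree_iff, isChargeFree_iff, hN, Set.ncard_image_of_injective _ e.injective]
  refine and_congr_right fun _ => ⟨fun h j hj => ?_, fun h j' hj' => ?_⟩
  · rw [← hring j]
    exact h (e j) ⟨j, hj, rfl⟩
  · obtain ⟨j, hj, rfl⟩ := hj'
    rw [hring j]
    exact h j hj

end Locality

/-! ### The exact fcc 13-cluster (integer coordinates, scale `√2`): the FIRST certified charge-free site -/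

/-- integer coordinates: centre `0` and the cuboctahedral shell `(±1,±1,0), (±1,0,±1), (0,±1,±1)`. -/
def fccCoord : Fin 13 → Fin 3 → ℤ :=
  ![![0, 0, 0], ![1, 1, 0], ![1, -1, 0], ![-1, 1, 0], ![-1, -1, 0], ![1, 0, 1], ![1, 0, -1],
    ![-1, 0, 1], ![-1, 0, -1], ![0, 1, 1], ![0, 1, -1], ![0, -1, 1], ![0, -1, -1]]

/-- squared distances (an integer table). -/
def Tsq (i j : Fin 13) : ℤ :=
  (fccCoord i 0 - fccCoord j 0) ^ 2 + (fccCoord i 1 - fccCoord j 1) ^ 2 + (fccCoord i 2 - fccCoord j 2) ^ 2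

/-- the cluster as points of `ℝ³`. -/
def fcc13 : Fin 13 → E3 := fun k => WithLp.toLp 2 fun t => (fccCoord k t : ℝ)

theorem fcc13_apply (k : Fin 13) (t : Fin 3) : (fcc13 k) t = (fccCoord k t : ℝ) := rfl

theorem dist_fcc13 (i j : Fin 13) : dist (fcc13 i) (fcc13 j) = Real.sqrt (Tsq i j) := by
  rw [EuclideanSpace.dist_eq]
  congr 1
  simp only [Fin.sum_univ_three, Real.dist_eq, sq_abs, Tsq]
  push_cast
  rfl

-- the finite facts about the table, by `decide`
theorem Tsq_two_le : ∀ i j : Fin 13, i ≠ j → 2 ≤ Tsq i j := by decide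
theorem Tsq_exists_two : ∀ i : Fin 13, ∃ j : Fin 13, j ≠ i ∧ Tsq i j = 2 := by decide
theorem Tsq_three_le : ∀ i j : Fin 13, i ≠ j → Tsq i j ≠ 2 → 3 ≤ Tsq i j := by decide

theorem nearestDist_fcc13 (k : Fin 13) : nearestDist fcc13 k = Real.sqrt 2 := by
  obtain ⟨j, hj, hT⟩ := Tsq_exists_two k
  refine le_antisymm ?_ (le_nearestDist ⟨j, hj⟩ fun j' hj' => ?_)
  · have := nearestDist_le_dist fcc13 hj
    rwa [dist_fcc13, hT, Int.cast_ofNat] at this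
  · rw [dist_fcc13]
    exact Real.sqrt_le_sqrt (by exact_mod_cast Tsq_two_le k j' (Ne.symm hj'))

/-- bonds of the exact cluster at tolerance `1/100` are exactly the pairs at squared distance `2`. -/
theorem adj_fcc13_iff (i j : Fin 13) :
    (bondGraph (1 / 100 : ℝ) fcc13).Adj i j ↔ i ≠ j ∧ Tsq i j = 2 := by
  rw [bondGraph_adj, nearestDist_fcc13, nearestDist_fcc13, min_self, dist_fcc13]
  refine and_congr_right fun hne => ⟨fun h => ?_, fun h => ?_⟩
  · by_contra hT
    have h3 : (3 : ℝ) ≤ Tsq i j := by exact_mod_cast Tsq_three_le i j hne hT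
    have hlt : (1 + 1 / 100) * Real.sqrt 2 < Real.sqrt (Tsq i j) := by
      calc (1 + 1 / 100) * Real.sqrt 2 < Real.sqrt 3 := by
            rw [Real.lt_sqrt (by positivity), mul_pow, Real.sq_sqrt (by norm_num)]; norm_num
        _ ≤ Real.sqrt (Tsq i j) := Real.sqrt_le_sqrt h3
    linarith
  · rw [h, Int.cast_ofNat]
    have : (0 : ℝ) ≤ Real.sqrt 2 := Real.sqrt_nonneg 2
    nlinarith

/-- the neighbour set of the centre, as a finset. -/
theorem neighborSet_fcc13_zero :
    (bondGraph (1 / 100 : ℝ) fcc13).neighborSet 0 =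
      ↑(Finset.univ.filter fun j : Fin 13 => (0 : Fin 13) ≠ j ∧ Tsq 0 j = 2) := by
  ext j
  rw [SimpleGraph.mem_neighborSet, adj_fcc13_iff, Finset.coe_filter]
  simp

theorem neighborSet_fcc13 (i : Fin 13) :
    (bondGraph (1 / 100 : ℝ) fcc13).neighborSet i =
      ↑(Finset.univ.filter fun j : Fin 13 => i ≠ j ∧ Tsq i j = 2) := by
  ext j
  rw [SimpleGraph.mem_neighborSet, adj_fcc13_iff, Finset.coe_filter]
  simp

/-- **The centre of the exact fcc 13-cluster is charge-free at tolerance `1/100`** (12 bonds, every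
ring number 4) — a `decide` computation on the integer table of squared distances. -/
theorem isChargeFree_fcc13_zero : IsChargeFree (1 / 100 : ℝ) fcc13 0 := by
  rw [isChargeFree_iff]
  constructor
  · rw [neighborSet_fcc13, Set.ncard_coe_finset]; decide
  · intro j hj
    rw [neighborSet_fcc13, Finset.mem_coe, Finset.mem_filter] at hj
    rw [ringNumber_def, neighborSet_fcc13, neighborSet_fcc13, ← Finset.coe_inter,
      Set.ncard_coe_finset, ← Finset.filter_and]
    have key : ∀ j : Fin 13, (0 : Fin 13) ≠ j ∧ Tsq 0 j = 2 →
        (Finset.univ.filter fun k : Fin 13 => ((0 : Fin 13) ≠ k ∧ Tsq 0 k = 2) ∧ (j ≠ k ∧ Tsq j k = 2)).card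
          = 4 := by decide
    exact key j hj.2


/-! ### The far crowd around the fcc 13-cluster, and `¬ FragileChargePricing` -/

section Crowd13
open scoped BigOperators
open Literature.MathematicalPhysics.StatisticalMechanics

theorem e0_apply_zero : e0 0 = 1 := by simp [e0]

/-- coefficient of the `m`-th far point: in `(4, 5]`. -/
def farCoeff (M : ℕ) (m : Fin M) : ℝ := 4 + ((m : ℕ) + 1 : ℝ) / (M + 1)

theorem farCoeff_mem (M : ℕ) (m : Fin M) : 4 < farCoeff M m ∧ farCoeff M m ≤ 5 := by
  have hM : (0 : ℝ) < (M : ℝ) + 1 := by positivity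
  have h1 : (0 : ℝ) < ((m : ℕ) + 1 : ℝ) / (M + 1) := by positivity
  have h2 : ((m : ℕ) + 1 : ℝ) / (M + 1) ≤ 1 := by
    rw [div_le_one hM]
    have : (m : ℕ) + 1 ≤ M + 1 := by omega
    exact_mod_cast this
  unfold farCoeff; constructor <;> linarith

theorem farCoeff_injective (M : ℕ) : Function.Injective (farCoeff M) := by
  intro a b h
  unfold farCoeff at h
  have hM : (M : ℝ) + 1 ≠ 0 := by positivity
  have : ((a : ℕ) : ℝ) = ((b : ℕ) : ℝ) := by
    field_simp at h; linarith
  exact Fin.ext (by exact_mod_cast this)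

/-- the far crowd: `M` distinct points on the first axis at distances in `(4, 5]` from the origin. -/
def farCrowd (M : ℕ) : Fin M → E3 := fun m => farCoeff M m • e0

/-- THE WITNESS: the exact fcc 13-cluster followed by the far crowd. -/
def cfg (M : ℕ) : Fin (13 + M) → E3 := Fin.append fcc13 (farCrowd M)

/-- the embedding of the cluster indices. -/
def emb (M : ℕ) : Fin 13 ↪ Fin (13 + M) := ⟨Fin.castAdd M, Fin.castAdd_injective _ _⟩

theorem cfg_comp_emb (M : ℕ) : cfg M ∘ emb M = fcc13 := funext fun k => Fin.append_left _ _ k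

theorem cfg_emb (M : ℕ) (k : Fin 13) : cfg M (emb M k) = fcc13 k := Fin.append_left _ _ k

theorem cfg_natAdd (M : ℕ) (m : Fin M) : cfg M (Fin.natAdd 13 m) = farCrowd M m := Fin.append_right _ _ m

theorem not_mem_range_emb {M : ℕ} {j : Fin (13 + M)} (hj : j ∉ Set.range (emb M)) :
    ∃ m : Fin M, j = Fin.natAdd 13 m := by
  induction j using Fin.addCases with
  | left k => exact (hj ⟨k, rfl⟩).elim
  | right m => exact ⟨m, rfl⟩

theorem fcc13_zero : fcc13 0 = 0 := by
  ext t; rw [fcc13_apply]; fin_cases t <;> simp [fccCoord]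

/-- a coordinate difference is bounded by the distance. -/
theorem abs_sub_apply_le_dist (x y : E3) (t : Fin 3) : |x t - y t| ≤ dist x y := by
  rw [EuclideanSpace.dist_eq, ← Real.sqrt_sq_eq_abs]
  refine Real.sqrt_le_sqrt ?_
  have : dist (x.ofLp t) (y.ofLp t) ^ 2 ≤ ∑ i, dist (x.ofLp i) (y.ofLp i) ^ 2 :=
    Finset.single_le_sum (f := fun i => dist (x.ofLp i) (y.ofLp i) ^ 2) (fun i _ => sq_nonneg _)
      (Finset.mem_univ t)
  simpa [Real.dist_eq, sq_abs] using this

theorem fccCoord_zero_le_one : ∀ k : Fin 13, fccCoord k 0 ≤ 1 := by decide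

/-- every far point is at distance `≥ 3` from every cluster point. -/
theorem three_le_dist_far (M : ℕ) (k : Fin 13) (m : Fin M) : 3 ≤ dist (fcc13 k) (farCrowd M m) := by
  have h := abs_sub_apply_le_dist (fcc13 k) (farCrowd M m) 0
  have hx : (farCrowd M m) 0 = farCoeff M m := by
    simp [farCrowd, e0]
  rw [fcc13_apply, hx] at h
  have hk : (fccCoord k 0 : ℝ) ≤ 1 := by exact_mod_cast fccCoord_zero_le_one k
  have hf := (farCoeff_mem M m).1
  have : 3 ≤ |(fccCoord k 0 : ℝ) - farCoeff M m| := by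
    rw [abs_sub_comm, abs_of_pos (by linarith)]; linarith
  linarith

theorem dist_cfg_zero_far (M : ℕ) (m : Fin M) :
    dist (cfg M (emb M 0)) (cfg M (Fin.natAdd 13 m)) = farCoeff M m := by
  have hpos : (0 : ℝ) < farCoeff M m := by linarith [(farCoeff_mem M m).1]
  rw [cfg_emb, cfg_natAdd, fcc13_zero, dist_comm, dist_zero_right, farCrowd, norm_smul, norm_e0,
    mul_one, Real.norm_eq_abs, abs_of_pos hpos]

/-- **The centre of the cluster stays charge-free in the presence of the far crowd** (locality). -/
theorem isChargeFree_cfg_centre (M : ℕ) : IsChargeFree (1 / 100 : ℝ) (cfg M) (emb M 0) := by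
  have hcomp := cfg_comp_emb M
  rw [isChargeFree_iff_comp_of_far (cfg M) (emb M) (1 / 100 : ℝ) 0, hcomp]
  · exact isChargeFree_fcc13_zero
  · intro k j' hj'
    obtain ⟨m, rfl⟩ := not_mem_range_emb hj'
    rw [hcomp, nearestDist_fcc13, cfg_emb, cfg_natAdd]
    calc Real.sqrt 2 ≤ Real.sqrt (3 ^ 2) := Real.sqrt_le_sqrt (by norm_num)
      _ = 3 := Real.sqrt_sq (by norm_num)
      _ ≤ _ := three_le_dist_far M k m
  · intro j' hj' hadj
    obtain ⟨m, rfl⟩ := not_mem_range_emb hj'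
    have h1 := dist_le_of_adj (by norm_num : (0 : ℝ) ≤ 1 + 1 / 100) hadj
    have h2 : nearestDist (cfg M) (emb M 0) ≤ dist (cfg M (emb M 0)) (cfg M (emb M 1)) :=
      nearestDist_le_dist (cfg M) (fun h => absurd ((emb M).injective h) (by decide))
    rw [cfg_emb, cfg_emb, dist_fcc13, show Tsq 0 1 = 2 by decide, Int.cast_ofNat] at h2
    have h3 := three_le_dist_far M 0 m
    rw [cfg_emb, cfg_natAdd] at h1
    have h4 : Real.sqrt 2 < 2 := by rw [Real.sqrt_lt' (by norm_num)]; norm_num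
    nlinarith

/-- `V_LJ(d) ≤ -1/(12 R⁶)` for `1 ≤ d ≤ R`. -/
theorem lennardJones_le_of_le {d R : ℝ} (h1 : 1 ≤ d) (h2 : d ≤ R) :
    lennardJones d ≤ -1 / (12 * R ^ 6) := by
  have hd : 0 < d := by linarith
  have hR : 0 < R := by linarith
  set u : ℝ := (d⁻¹) ^ 6 with hu
  have hu0 : 0 ≤ d⁻¹ := by positivity
  have hu1 : u ≤ 1 := pow_le_one₀ hu0 (inv_le_one_of_one_le₀ h1)
  have hu2 : (R ^ 6)⁻¹ ≤ u := by
    rw [hu, ← inv_pow]; exact pow_le_pow_left₀ (by positivity) ((inv_le_inv₀ hR hd).2 h2) 6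
  have h12 : (d⁻¹) ^ 12 = u ^ 2 := by rw [hu]; ring
  have hR6 : 0 < R ^ 6 := by positivity
  unfold lennardJones
  rw [h12]
  have hu0' : 0 ≤ u := by positivity
  have : u ^ 2 ≤ u := by
    calc u ^ 2 = u * u := sq u
      _ ≤ u * 1 := mul_le_mul_of_nonneg_left hu1 hu0'
      _ = u := mul_one u
  calc 1 / 12 * u ^ 2 - 1 / 6 * u ≤ -(1 / 12) * u := by nlinarith
    _ ≤ -(1 / 12) * (R ^ 6)⁻¹ := by nlinarith
    _ = -1 / (12 * R ^ 6) := by field_simp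

theorem Tsq_zero_le_eight : ∀ k : Fin 13, Tsq 0 k ≤ 8 := by decide

/-- every pair term at the centre of the witness is `≤ -1/187500`. -/
theorem term_le (M : ℕ) {j : Fin (13 + M)} (hj : j ≠ emb M 0) :
    lennardJones (dist (cfg M (emb M 0)) (cfg M j)) ≤ -1 / (12 * (5 : ℝ) ^ 6) := by
  by_cases hr : j ∈ Set.range (emb M)
  · obtain ⟨k, rfl⟩ := hr
    have hk : k ≠ 0 := fun h => hj (by rw [h])
    rw [cfg_emb, cfg_emb, dist_fcc13]
    refine lennardJones_le_of_le ?_ ?_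
    · rw [← Real.sqrt_one]
      exact Real.sqrt_le_sqrt (by exact_mod_cast (Tsq_two_le 0 k (Ne.symm hk)).trans' (by norm_num))
    · have : (Tsq 0 k : ℝ) ≤ 8 := by exact_mod_cast Tsq_zero_le_eight k
      calc Real.sqrt (Tsq 0 k) ≤ Real.sqrt (5 ^ 2) := Real.sqrt_le_sqrt (by linarith)
        _ = 5 := Real.sqrt_sq (by norm_num)
  · obtain ⟨m, rfl⟩ := not_mem_range_emb hr
    rw [dist_cfg_zero_far]
    exact lennardJones_le_of_le (by linarith [(farCoeff_mem M m).1]) (farCoeff_mem M m).2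

theorem cfg_injective (M : ℕ) : Function.Injective (cfg M) := by
  intro a b hab
  induction a using Fin.addCases with
  | left k =>
    induction b using Fin.addCases with
    | left k' =>
      -- two cluster points
      by_contra hne
      have hkk : k ≠ k' := fun h => hne (by rw [h])
      have h2 : (2 : ℝ) ≤ Tsq k k' := by exact_mod_cast Tsq_two_le k k' hkk
      have hd : dist (fcc13 k) (fcc13 k') = 0 := by
        rw [← cfg_emb M k, ← cfg_emb M k']; exact dist_eq_zero.2 hab
      rw [dist_fcc13, Real.sqrt_eq_zero'] at hd
      linarith
    | right m =>
      exfalso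
      have h := three_le_dist_far M k m
      have hab' : cfg M (emb M k) = cfg M (Fin.natAdd 13 m) := hab
      rw [← cfg_emb M k, ← cfg_natAdd M m, hab', dist_self] at h
      linarith
  | right m =>
    induction b using Fin.addCases with
    | left k' =>
      exfalso
      have h := three_le_dist_far M k' m
      have hab' : cfg M (Fin.natAdd 13 m) = cfg M (emb M k') := hab
      rw [← cfg_emb M k', ← cfg_natAdd M m, ← hab', dist_self] at h
      linarith
    | right m' =>
      have h : farCrowd M m = farCrowd M m' := by rw [← cfg_natAdd, ← cfg_natAdd, hab]
      have := farCoeff_injective M (smul_left_injective ℝ e0_ne_zero h)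
      rw [this]

end Crowd13

section NotFragile
open scoped BigOperators
open Literature.MathematicalPhysics.StatisticalMechanics


/-- the identity is a near-similarity for every `θ ≥ 0`. -/
theorem isNearSimilarity_id {θ : ℝ} (hθ : 0 ≤ θ) : CutAndAdapt.IsNearSimilarity θ id := by
  refine ⟨contDiff_id, fun x => ⟨1, one_pos, ?_, ?_⟩⟩
  · rw [fderiv_id, one_smul, sub_self, norm_zero]; simpa using hθ
  · have h1 : fderiv ℝ (id : E3 → E3) = fun _ => ContinuousLinearMap.id ℝ E3 := by
      funext z; exact fderiv_id
    rw [h1]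
    have h2 : fderiv ℝ (fun _ : E3 => ContinuousLinearMap.id ℝ E3) x = 0 := by simp
    rw [h2]
    exact le_trans (le_of_eq ContinuousLinearMap.opNorm_zero) (by simpa using hθ)

theorem sum_centre_le (M : ℕ) :
    ∑ j ∈ Finset.univ.erase (emb M 0), lennardJones (dist (cfg M (emb M 0)) (cfg M j)) ≤
      -(M : ℝ) / 187500 := by
  have hc : ∀ j ∈ Finset.univ.erase (emb M 0),
      lennardJones (dist (cfg M (emb M 0)) (cfg M j)) ≤ -1 / (12 * (5 : ℝ) ^ 6) :=
    fun j hj => term_le M (Finset.ne_of_mem_erase hj)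
  have hcard : (M : ℝ) ≤ ((Finset.univ.erase (emb M 0)).card : ℝ) := by
    have : M ≤ (Finset.univ.erase (emb M 0)).card := by
      rw [Finset.card_erase_of_mem (Finset.mem_univ _), Finset.card_univ, Fintype.card_fin]; omega
    exact_mod_cast this
  calc ∑ j ∈ Finset.univ.erase (emb M 0), lennardJones (dist (cfg M (emb M 0)) (cfg M j))
      ≤ ∑ _j ∈ Finset.univ.erase (emb M 0), (-1 / (12 * (5 : ℝ) ^ 6)) := Finset.sum_le_sum hc
    _ = ((Finset.univ.erase (emb M 0)).card : ℝ) * (-1 / (12 * (5 : ℝ) ^ 6)) := by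
        rw [Finset.sum_const, nsmul_eq_mul]
    _ ≤ -(M : ℝ) / 187500 := by
        have : -1 / (12 * (5 : ℝ) ^ 6) = -(1 / 187500) := by norm_num
        rw [this]; nlinarith

/-- **`FragileChargePricing` (card cut-and-adapt-envelope, "fragile charge is elastic") is FALSE as
stated.**  Witness: the exact fcc 13-cluster (centre charge-free: `isChargeFree_fcc13_zero`, carried
over to the witness by the locality lemma `isChargeFree_iff_comp_of_far`) plus `M` far points on a
ray at distances in `(4, 5]` from the centre; `Ω = {centre}`, `φ = id`.  The left side is `≥ -|C|`,
the right side is `½ Σ_{j ≠ centre} V_LJ ≤ -M/375000` minus `e*`; take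
`M = ⌈375000(|C| + |e*|)⌉ + 1`.  Same root cause as `not_weakFarField`: a REGIONAL statement about
half-pair site functionals has no hard core unless one is written into it; REPAIR: add
`∀ i ≠ j, r₀ ≤ dist (y i) (y j)`.  Classification: misstated. -/
theorem not_fragileChargePricing : ¬ CutAndAdapt.FragileChargePricing := by
  rintro ⟨θ, κf, C, hθ, hκf, h⟩
  set M : ℕ := ⌈375000 * (|C| + |eStar|)⌉₊ + 1 with hM
  have hMlt : 375000 * (|C| + |eStar|) < M := by
    have h1 : 375000 * (|C| + |eStar|) ≤ ⌈375000 * (|C| + |eStar|)⌉₊ := Nat.le_ceil _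
    have h2 : ((⌈375000 * (|C| + |eStar|)⌉₊ + 1 : ℕ) : ℝ) = ⌈375000 * (|C| + |eStar|)⌉₊ + 1 := by
      push_cast; ring
    rw [hM, h2]; linarith
  have hyp : ∀ i ∈ ({emb M 0} : Finset (Fin (13 + M))), ∃ φ : E3 → E3,
      CutAndAdapt.IsNearSimilarity θ φ ∧ IsChargeFree (1 / 100 : ℝ) (φ ∘ cfg M) i := by
    intro i hi
    rw [Finset.mem_singleton] at hi
    subst hi
    exact ⟨id, isNearSimilarity_id hθ.le, by simpa using isChargeFree_cfg_centre M⟩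
  have key := h (13 + M) (cfg M) (cfg_injective M) {emb M 0} hyp
  rw [Finset.sum_singleton] at key
  -- the two counting terms
  have hA : (0 : ℝ) ≤ κf * (Nat.card {i : Fin (13 + M) // i ∈ ({emb M 0} : Finset (Fin (13 + M))) ∧
      ¬ IsChargeFree (1 / 100 : ℝ) (cfg M) i} : ℝ) := by positivity
  have hB : (Nat.card {i : Fin (13 + M) // i ∈ ({emb M 0} : Finset (Fin (13 + M))) ∧
      ∃ j : Fin (13 + M), j ∉ ({emb M 0} : Finset (Fin (13 + M))) ∧
        dist (cfg M j) (cfg M i) ≤ 4 * nearestDist (cfg M) i} : ℝ) ≤ 1 := by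
    have hsub : Subsingleton {i : Fin (13 + M) // i ∈ ({emb M 0} : Finset (Fin (13 + M))) ∧
        ∃ j : Fin (13 + M), j ∉ ({emb M 0} : Finset (Fin (13 + M))) ∧
          dist (cfg M j) (cfg M i) ≤ 4 * nearestDist (cfg M) i} :=
      ⟨fun a b => Subtype.ext
        ((Finset.mem_singleton.1 a.2.1).trans (Finset.mem_singleton.1 b.2.1).symm)⟩
    exact_mod_cast Finite.card_le_one_iff_subsingleton.2 hsub
  have hB0 : (0 : ℝ) ≤ (Nat.card {i : Fin (13 + M) // i ∈ ({emb M 0} : Finset (Fin (13 + M))) ∧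
      ∃ j : Fin (13 + M), j ∉ ({emb M 0} : Finset (Fin (13 + M))) ∧
        dist (cfg M j) (cfg M i) ≤ 4 * nearestDist (cfg M) i} : ℝ) := Nat.cast_nonneg _
  have hS := sum_centre_le M
  have hC1 := le_abs_self C
  have hC2 := neg_abs_le C
  have he1 := le_abs_self eStar
  have he2 := neg_abs_le eStar
  nlinarith

end NotFragile

namespace ShapeTransfer

/-- verbatim copy of `…Cruxes.LocalToGlobal.Sketch.RelativeCoercivity` (SketchIdeator3.lean, card
`scale-free-shape-transfer`).  VERDICT (the ideator's OWN mismatch lemma (M), BarrierNotesIdeator3.md,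
confirmed): **false for every `θ, lam, C`** modulo (U2): at `y` = `N`-blocks of the LJ-optimal hcp the
right side is `O(N^{2/3})` while `E_χ(lam • y) − N e_χ* ≥ N · m_χ − O(N^{2/3})` with the dilation sliver
`m_χ = min_s e_χ(s · hcp*_V) − e_χ* = 1.85e-6 > 0` (two independent lattice-sum computations:
ideator 1: 1.96e-6).  Not certifiable in Lean for the same reason as everything with `e*` on the
favourable side (needs `e* ≥ e_LJ(hcp) − o(1)`, i.e. crystallization).  The proved reduction
`localToGlobal_of_relativeCoercivity` of the sketch is therefore a reduction to a false statement. -/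
def RelativeCoercivity : Prop :=
  ∃ θ lam C : ℝ, 0 < θ ∧ 0 < lam ∧ ∀ (N : ℕ) (y : Fin N → E3), Function.Injective y →
    θ * (interactionEnergy Vchi (lam • y) - (N : ℝ) * eChiStar) - C * (N : ℝ) ^ (2 / 3 : ℝ)
      ≤ interactionEnergy lennardJones y - (N : ℝ) * eStar

end ShapeTransfer

/-! ## §6 Near-misses (paper refutations this seat could not certify; `sorry` allowed only here) -/

/-- NEAR-MISS `not_robustChargeViaCensusInner`: teleported vacancy filling, see the docstring of
`CutAndAdapt.RobustChargeViaCensusInner`.  (The card's statement proper, `TruncatedCensusGap → inner`,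
is even less certifiably false: its negation needs a PROOF of the antecedent.) -/
theorem not_robustChargeViaCensusInner_nearMiss : ¬ CutAndAdapt.RobustChargeViaCensusInner := by
  sorry

/-- NEAR-MISS `not_cutAndAdaptDomination`: see the docstring of `CutAndAdapt.CutAndAdaptDomination`
(twist-wall laminates; kernel `no_rankOne_connection_twist` certified in §4).  OBSTRUCTION TO CERTIFYING:
`e*` on the favourable side (a Lean proof needs `e* ≥ e_LJ(hcp*) − o(1)`), plus the analytic inputs
(U1)–(U3). -/
theorem not_cutAndAdaptDomination_nearMiss : ¬ CutAndAdapt.CutAndAdaptDomination := by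
  sorry

/-- NEAR-MISS `not_relativeCoercivity`: see the docstring of `ShapeTransfer.RelativeCoercivity`
(dilation sliver `m_χ N` against `O(N^{2/3})`).  OBSTRUCTION TO CERTIFYING: `e*` on the favourable side. -/
theorem not_relativeCoercivity_nearMiss : ¬ ShapeTransfer.RelativeCoercivity := by
  sorry

end Summit.AtomisticToContinuum.Crystallization.Cruxes.LocalToGlobal.Disproof

end
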